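import Summits.CriticalPhenomena.PercolationContinuityZ3.Theorems.PercNearOneGluingNoHeavyLowerTailSahiOneStepOrLiteral
import HarnessLib

/-!
# One-step scheme: the GENERAL PIVOT STEP via an exact certificate identity

Prover prim-ineq-prove-3 gen 27 (`--supports stmt-CriticalPhenomena-4575`; memo
`run/shared/lean/prim/prim-ineq-prove-3/FINDING-G27-PIVOT-CERTIFICATE.md`).  No definitions, no sorries.

Setting of the one-coordinate step (gen 19, `osN_ind_ind_nonneg_of_step`): `e ∉ F`, slot `{N_{insert e F} ≥ t+1}`, increasing `A, B`
(ARBITRARY), sections `A¹ ⊇ A⁰`, `B¹ ⊇ B⁰` at `e`, `L¹ = {N_F < t}`, `S = {N_F = t}`, `L⁰ = {N_F < t+1}`, `H¹ = (L¹)ᶜ`, `H⁰ = (L⁰)ᶜ`,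
`ℓ¹ = μ L¹`, `σ = μ S`, `ℓ⁰ = ℓ¹ + σ`.  For every real `r` the step form `M₂` satisfies the POLYNOMIAL IDENTITY
`ℓ¹ℓ⁰·M₂ = ℓ⁰²·n_{H¹}(A¹,B¹) + ℓ¹(ℓ¹ − rℓ⁰)·n_{H⁰}(A¹,B⁰) + rℓ¹ℓ⁰·n_{H⁰}(A⁰,B⁰) + X̃_B·U_{A¹}`
`        + ℓ¹ℓ⁰·[e_I·μ(E_A ∩ L⁰) + e_II·μ(E_A ∩ H⁰ ∖ B⁰) + e_III·μ(E_A ∩ H⁰ ∩ B⁰)]`,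
where `E_A = A¹ ∖ A⁰`, `U_{A¹} = ℓ¹μ(A¹ ∩ S) − σμ(A¹ ∩ L¹) ≥ 0` (`real_inter_ball_mul_layer_le'`),
`X̃_B = ℓ⁰μ(B¹ ∩ L¹) − ℓ¹μ(B⁰ ∩ L⁰)` ("the pivot helps `B` inside the ball": `X̃_B ≥ 0 ⟺ Cov_{μ(·∣N<t+1)}(1_B, x_e) ≥ 0`),
`e_I = (ℓ¹b¹ − μ(B¹L¹)) − r(ℓ⁰b⁰ − μ(B⁰L⁰))`, `e_II = ℓ¹b¹ − rℓ⁰b⁰`, `e_III = rℓ⁰(1 − b⁰) − ℓ¹(1 − b¹)` (`b^y = μ B^y`).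
Hence (`osN_threshold_step_of_pivotCertificate`): `(2′)` for `(A,B)` follows from `(2′)` for the three section pairs `(A¹,B¹)@H¹`,
`(A¹,B⁰)@H⁰`, `(A⁰,B⁰)@H⁰` as soon as `X̃_B ≥ 0` and some `0 ≤ r ≤ ℓ¹/ℓ⁰` makes `e_I, e_II, e_III ≥ 0`; with
`r = ℓ¹(1−b¹)/(ℓ⁰(1−b⁰))` this is the pair of conditions **`X̃_B ≥ 0` and `Ψ_B ≥ 0`**,
`Ψ_B = ℓ⁰(1−b⁰)(ℓ¹b¹ − μ(B¹L¹)) − ℓ¹(1−b¹)(ℓ⁰b⁰ − μ(B⁰L⁰))` (`osN_threshold_goodPivot_step`) — conditions on `B` ALONE.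
The AND-literal step (`B⁰ = ∅`) and the OR-literal step (`B¹ = univ`) of gen 25/26 are the two extreme special cases.
The companion file `…SahiOneStepGoodPivotReduction` derives `(2′)` for ALL pairs (every product measure) from the GOOD-PIVOT property
(`X̃ ≥ 0 ∧ Ψ ≥ 0` at some counted pivot, for every increasing event).
-/

noncomputable section

namespace Summit.CriticalPhenomena.PercolationContinuityZ3.Theorems

namespace SahiOneStep

open MeasureTheory Finset
open Literature.Probability.Percolation (DeterminedBy determinedBy_iff determinedBy_univ)
open Literature.Probability.LatticeModels (prodBernoulli sahiE3 prodBernoulli_harris)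
open Literature.Probability.Percolation.DecisionTree (ind)
open scoped Classical

variable {ι : Type*} [Fintype ι]

/-! ## The general pivot step from an explicit certificate -/

/-- **THE PIVOT STEP WITH AN EXPLICIT CERTIFICATE.**  `e ∉ F`; `A, B` increasing (arbitrary); slot `{N_{insert e F} ≥ t+1}`.  Suppose
`(2′)` holds for `(A¹,B¹)` at `{N_F ≥ t}` and for `(A¹,B⁰)`, `(A⁰,B⁰)` at `{N_F ≥ t+1}`, that the pivot helps `B` inside the ball
(`ℓ¹·μ(B⁰ ∩ L⁰) ≤ ℓ⁰·μ(B¹ ∩ L¹)`), and that some `r` with `0 ≤ r`, `rℓ⁰ ≤ ℓ¹` makes the three certificate coefficients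
`e_I, e_II, e_III` nonnegative.  Then `(2′)` holds for `(A,B)`. [this work] -/
theorem osN_threshold_step_of_pivotCertificate (p : ι → unitInterval) {F : Finset ι} {e : ι} (he : e ∉ F) (t : ℕ)
    {A B : Set (Set ι)} (hA : IsUpperSet A) (hB : IsUpperSet B) (r : ℝ) (hr0 : 0 ≤ r)
    (hr1 : r * (prodBernoulli p).real {ω : Set ι | (F.filter (· ∈ ω)).card < t + 1} ≤
      (prodBernoulli p).real {ω : Set ι | (F.filter (· ∈ ω)).card < t})
    (h11 : 0 ≤ osN p {ω : Set ι | t ≤ (F.filter (· ∈ ω)).card} (ind {ω : Set ι | insert e ω ∈ A}) (ind {ω : Set ι | insert e ω ∈ B}))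
    (h10 : 0 ≤ osN p {ω : Set ι | t + 1 ≤ (F.filter (· ∈ ω)).card} (ind {ω : Set ι | insert e ω ∈ A}) (ind {ω : Set ι | ω \ {e} ∈ B}))
    (h00 : 0 ≤ osN p {ω : Set ι | t + 1 ≤ (F.filter (· ∈ ω)).card} (ind {ω : Set ι | ω \ {e} ∈ A}) (ind {ω : Set ι | ω \ {e} ∈ B}))
    (hX : (prodBernoulli p).real {ω : Set ι | (F.filter (· ∈ ω)).card < t} *
        (prodBernoulli p).real ({ω : Set ι | ω \ {e} ∈ B} ∩ {ω : Set ι | (F.filter (· ∈ ω)).card < t + 1}) ≤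
      (prodBernoulli p).real {ω : Set ι | (F.filter (· ∈ ω)).card < t + 1} *
        (prodBernoulli p).real ({ω : Set ι | insert e ω ∈ B} ∩ {ω : Set ι | (F.filter (· ∈ ω)).card < t}))
    (heI : r * ((prodBernoulli p).real {ω : Set ι | (F.filter (· ∈ ω)).card < t + 1} * (prodBernoulli p).real {ω : Set ι | ω \ {e} ∈ B}
          - (prodBernoulli p).real ({ω : Set ι | ω \ {e} ∈ B} ∩ {ω : Set ι | (F.filter (· ∈ ω)).card < t + 1})) ≤
        (prodBernoulli p).real {ω : Set ι | (F.filter (· ∈ ω)).card < t} * (prodBernoulli p).real {ω : Set ι | insert e ω ∈ B}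
          - (prodBernoulli p).real ({ω : Set ι | insert e ω ∈ B} ∩ {ω : Set ι | (F.filter (· ∈ ω)).card < t}))
    (heII : r * ((prodBernoulli p).real {ω : Set ι | (F.filter (· ∈ ω)).card < t + 1} * (prodBernoulli p).real {ω : Set ι | ω \ {e} ∈ B}) ≤
        (prodBernoulli p).real {ω : Set ι | (F.filter (· ∈ ω)).card < t} * (prodBernoulli p).real {ω : Set ι | insert e ω ∈ B})
    (heIII : (prodBernoulli p).real {ω : Set ι | (F.filter (· ∈ ω)).card < t} * (1 - (prodBernoulli p).real {ω : Set ι | insert e ω ∈ B}) ≤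
        r * ((prodBernoulli p).real {ω : Set ι | (F.filter (· ∈ ω)).card < t + 1} * (1 - (prodBernoulli p).real {ω : Set ι | ω \ {e} ∈ B}))) :
    0 ≤ osN p {ω : Set ι | t + 1 ≤ ((insert e F).filter (· ∈ ω)).card} (ind A) (ind B) := by
  set μ := prodBernoulli p with hμ
  set H1 : Set (Set ι) := {ω : Set ι | t ≤ (F.filter (· ∈ ω)).card} with hH1
  set H0 : Set (Set ι) := {ω : Set ι | t + 1 ≤ (F.filter (· ∈ ω)).card} with hH0
  set L1 : Set (Set ι) := {ω : Set ι | (F.filter (· ∈ ω)).card < t} with hL1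
  set L0 : Set (Set ι) := {ω : Set ι | (F.filter (· ∈ ω)).card < t + 1} with hL0
  set S : Set (Set ι) := {ω : Set ι | (F.filter (· ∈ ω)).card = t} with hS
  set A1 : Set (Set ι) := {ω : Set ι | insert e ω ∈ A} with hA1
  set A0 : Set (Set ι) := {ω : Set ι | ω \ {e} ∈ A} with hA0
  set B1 : Set (Set ι) := {ω : Set ι | insert e ω ∈ B} with hB1
  set B0 : Set (Set ι) := {ω : Set ι | ω \ {e} ∈ B} with hB0
  have sH1 : {ω : Set ι | insert e ω ∈ {ω : Set ι | t + 1 ≤ ((insert e F).filter (· ∈ ω)).card}} = H1 := section_insert_threshold he t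
  have sH0 : {ω : Set ι | ω \ {e} ∈ {ω : Set ι | t + 1 ≤ ((insert e F).filter (· ∈ ω)).card}} = H0 := section_sdiff_threshold he t
  have hA1u : IsUpperSet A1 := isUpperSet_section_insert hA e
  have hB1u : IsUpperSet B1 := isUpperSet_section_insert hB e
  have hA01 : A0 ⊆ A1 := section_sdiff_subset_section_insert hA e
  have hB01 : B0 ⊆ B1 := section_sdiff_subset_section_insert hB e
  have hH01 : H0 ⊆ H1 := fun ω hω => by simp only [hH0, hH1, Set.mem_setOf_eq] at hω ⊢; omega
  refine osN_ind_ind_nonneg_of_step p {ω : Set ι | t + 1 ≤ ((insert e F).filter (· ∈ ω)).card} A B e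
    ?_ ?_ ?_ ?_ ?_ ?_
  · rw [sH1]; exact h11
  · rw [sH0]; exact h00
  rotate_left
  · rw [sH1, sH0]; exact measureReal_mono hH01
  · exact measureReal_mono hA01
  · exact measureReal_mono hB01
  rw [sH1, sH0]
  -- piece measures
  set l1 : ℝ := μ.real L1 with hl1
  set σ : ℝ := μ.real S with hσ
  set aL : ℝ := μ.real (A1 ∩ L1) with haL
  set aS : ℝ := μ.real (A1 ∩ S) with haS
  set aH : ℝ := μ.real (H0 ∩ A1) with haH
  set a0L : ℝ := μ.real (A0 ∩ L1) with ha0L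
  set a0S : ℝ := μ.real (A0 ∩ S) with ha0S
  set a0H : ℝ := μ.real (H0 ∩ A0) with ha0H
  set bL : ℝ := μ.real (B1 ∩ L1) with hbL
  set bS : ℝ := μ.real (B1 ∩ S) with hbS
  set bH : ℝ := μ.real (H0 ∩ B1) with hbH
  set b0L : ℝ := μ.real (B0 ∩ L1) with hb0L
  set b0S : ℝ := μ.real (B0 ∩ S) with hb0S
  set b0H : ℝ := μ.real (H0 ∩ B0) with hb0H
  set cL : ℝ := μ.real ((A1 ∩ B1) ∩ L1) with hcL
  set cS : ℝ := μ.real ((A1 ∩ B1) ∩ S) with hcS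
  set cH : ℝ := μ.real (H0 ∩ (A1 ∩ B1)) with hcH
  set c10 : ℝ := μ.real (H0 ∩ A1 ∩ B0) with hc10
  set c00 : ℝ := μ.real (H0 ∩ A0 ∩ B0) with hc00
  -- set identities used for the splits
  have cL0 : ∀ X : Set (Set ι), X \ H0 = X ∩ L0 := fun X => by
    ext ω; simp only [hH0, hL0, Set.mem_sdiff, Set.mem_inter_iff, Set.mem_setOf_eq, not_le]
  have cS' : ∀ X : Set (Set ι), (X ∩ L0) \ L1 = X ∩ S := fun X => by
    ext ω; simp only [hL0, hL1, hS, Set.mem_sdiff, Set.mem_inter_iff, Set.mem_setOf_eq, not_lt]; constructor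
    · rintro ⟨⟨hX, h1⟩, h2⟩; exact ⟨hX, by omega⟩
    · rintro ⟨hX, h⟩; exact ⟨⟨hX, by omega⟩, by omega⟩
  have cSL : ∀ X : Set (Set ι), (X ∩ L0) ∩ L1 = X ∩ L1 := fun X => by
    ext ω; simp only [hL0, hL1, Set.mem_inter_iff, Set.mem_setOf_eq]; constructor
    · rintro ⟨⟨hX, _⟩, h2⟩; exact ⟨hX, h2⟩
    · rintro ⟨hX, h⟩; exact ⟨⟨hX, by omega⟩, h⟩
  have cH1S : ∀ X : Set (Set ι), (H1 ∩ X) \ H0 = X ∩ S := fun X => by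
    ext ω; simp only [hH1, hH0, hS, Set.mem_sdiff, Set.mem_inter_iff, Set.mem_setOf_eq, not_le]; constructor
    · rintro ⟨⟨h1, hX⟩, h2⟩; exact ⟨hX, by omega⟩
    · rintro ⟨hX, h⟩; exact ⟨⟨by omega, hX⟩, by omega⟩
  have cH1H0 : ∀ X : Set (Set ι), (H1 ∩ X) ∩ H0 = H0 ∩ X := fun X => by
    ext ω; simp only [Set.mem_inter_iff]; constructor
    · rintro ⟨⟨_, hX⟩, h0⟩; exact ⟨h0, hX⟩
    · rintro ⟨h0, hX⟩; exact ⟨⟨hH01 h0, hX⟩, h0⟩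
  -- splits: μ X = μ(H0 ∩ X) + μ(X ∩ L0), μ(X ∩ L0) = μ(X ∩ L1) + μ(X ∩ S), μ(H1 ∩ X) = μ(X ∩ S) + μ(H0 ∩ X)
  have split0 : ∀ X : Set (Set ι), μ.real X = μ.real (H0 ∩ X) + μ.real (X ∩ L0) := fun X => by
    have h := measureReal_inter_add_sdiff (μ := μ) (s := X) (t := H0) MeasurableSet.of_discrete
    rw [cL0, Set.inter_comm X H0] at h; linarith
  have splitS : ∀ X : Set (Set ι), μ.real (X ∩ L0) = μ.real (X ∩ L1) + μ.real (X ∩ S) := fun X => by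
    have h := measureReal_inter_add_sdiff (μ := μ) (s := X ∩ L0) (t := L1) MeasurableSet.of_discrete
    rw [cSL, cS'] at h; linarith
  have splitH1 : ∀ X : Set (Set ι), μ.real (H1 ∩ X) = μ.real (X ∩ S) + μ.real (H0 ∩ X) := fun X => by
    have h := measureReal_inter_add_sdiff (μ := μ) (s := H1 ∩ X) (t := H0) MeasurableSet.of_discrete
    rw [cH1H0, cH1S] at h; linarith
  -- the named quantities
  have eA1 : μ.real A1 = aH + (aL + aS) := by rw [split0 A1, splitS A1]
  have eA0 : μ.real A0 = a0H + (a0L + a0S) := by rw [split0 A0, splitS A0]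
  have eB1 : μ.real B1 = bH + (bL + bS) := by rw [split0 B1, splitS B1]
  have eB0 : μ.real B0 = b0H + (b0L + b0S) := by rw [split0 B0, splitS B0]
  have eH1A1 : μ.real (H1 ∩ A1) = aS + aH := splitH1 A1
  have eH1B1 : μ.real (H1 ∩ B1) = bS + bH := splitH1 B1
  have eH1AB : μ.real (H1 ∩ A1 ∩ B1) = cS + cH := by rw [Set.inter_assoc]; exact splitH1 (A1 ∩ B1)
  have eAB : μ.real (A1 ∩ B1) = cH + (cL + cS) := by rw [split0 (A1 ∩ B1), splitS (A1 ∩ B1)]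
  have eA1L0 : μ.real (A1 ∩ L0) = aL + aS := splitS A1
  have eA0L0 : μ.real (A0 ∩ L0) = a0L + a0S := splitS A0
  have eB0L0 : μ.real (B0 ∩ L0) = b0L + b0S := splitS B0
  have eL0 : μ.real L0 = l1 + σ := by have h := splitS Set.univ; simp only [Set.univ_inter] at h; exact h
  have eH1 : μ.real H1 = 1 - l1 := by
    have h := splitH1 Set.univ; have h' := split0 Set.univ
    simp only [Set.inter_univ, Set.univ_inter, probReal_univ] at h h'; linarith
  have eH0 : μ.real H0 = 1 - l1 - σ := by
    have h' := split0 Set.univ; simp only [Set.inter_univ, Set.univ_inter, probReal_univ] at h'; linarith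
  -- the three E-terms: E_A = A1 \ A0 restricted to L0, to H0 \ B0 and to H0 ∩ B0
  have hE1 : a0L + a0S ≤ aL + aS := by
    rw [← eA1L0, ← eA0L0]; exact measureReal_mono (Set.inter_subset_inter_left _ hA01)
  have eD1 : μ.real ((H0 ∩ A1) \ B0) = aH - c10 := by
    have h := measureReal_inter_add_sdiff (μ := μ) (s := H0 ∩ A1) (t := B0) MeasurableSet.of_discrete; linarith
  have eD0 : μ.real ((H0 ∩ A0) \ B0) = a0H - c00 := by
    have h := measureReal_inter_add_sdiff (μ := μ) (s := H0 ∩ A0) (t := B0) MeasurableSet.of_discrete; linarith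
  have hE2 : a0H - c00 ≤ aH - c10 := by
    rw [← eD1, ← eD0]
    exact measureReal_mono (Set.sdiff_subset_sdiff_left (Set.inter_subset_inter_right _ hA01))
  have hE3 : c00 ≤ c10 :=
    measureReal_mono (Set.inter_subset_inter_left _ (Set.inter_subset_inter_right _ hA01))
  -- layer ≥ lower ball for `A1`
  have hUA : aL * σ ≤ aS * l1 := real_inter_ball_mul_layer_le' p F hA1u t
  -- the three section hypotheses, unfolded
  have h11' := h11
  rw [osN_ind_ind] at h11'
  change 0 ≤ μ.real (H1 ∩ A1) * μ.real (H1 ∩ B1) + (1 - μ.real H1) * μ.real (H1 ∩ A1 ∩ B1) + μ.real H1 * μ.real A1 * μ.real B1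
      - μ.real (H1 ∩ A1) * μ.real B1 - μ.real (H1 ∩ B1) * μ.real A1 at h11'
  rw [eH1A1, eH1B1, eH1AB, eH1, eA1, eB1] at h11'
  have h10' := h10
  rw [osN_ind_ind] at h10'
  change 0 ≤ aH * b0H + (1 - μ.real H0) * c10 + μ.real H0 * μ.real A1 * μ.real B0 - aH * μ.real B0 - b0H * μ.real A1 at h10'
  rw [eH0, eA1, eB0] at h10'
  have h00' := h00
  rw [osN_ind_ind] at h00'
  change 0 ≤ a0H * b0H + (1 - μ.real H0) * c00 + μ.real H0 * μ.real A0 * μ.real B0 - a0H * μ.real B0 - b0H * μ.real A0 at h00'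
  rw [eH0, eA0, eB0] at h00'
  -- the certificate hypotheses in piece variables
  rw [eB0L0, eL0] at hX
  change l1 * (b0L + b0S) ≤ (l1 + σ) * bL at hX
  rw [eL0, eB0, eB0L0, eB1] at heI
  change r * ((l1 + σ) * (b0H + (b0L + b0S)) - (b0L + b0S)) ≤ l1 * (bH + (bL + bS)) - bL at heI
  rw [eL0, eB0, eB1] at heII
  change r * ((l1 + σ) * (b0H + (b0L + b0S))) ≤ l1 * (bH + (bL + bS)) at heII
  rw [eL0, eB0, eB1] at heIII
  change l1 * (1 - (bH + (bL + bS))) ≤ r * ((l1 + σ) * (1 - (b0H + (b0L + b0S)))) at heIII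
  rw [eL0] at hr1
  change r * (l1 + σ) ≤ l1 at hr1
  -- rewrite the goal in the piece variables
  rw [eA0, eH1, eA1, eH1A1, eB1, eH1B1, eB0, eH1AB, eH0]
  -- nonnegativity of the pieces
  have hl1 : 0 ≤ l1 := measureReal_nonneg
  have hσ0 : 0 ≤ σ := measureReal_nonneg
  have haL0 : 0 ≤ aL := measureReal_nonneg
  have hbL0 : 0 ≤ bL := measureReal_nonneg
  have haLl : aL ≤ l1 := measureReal_mono Set.inter_subset_right
  have hbLl : bL ≤ l1 := measureReal_mono Set.inter_subset_right
  have ha0Ll : a0L ≤ l1 := measureReal_mono Set.inter_subset_right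
  have hb0Ll : b0L ≤ l1 := measureReal_mono Set.inter_subset_right
  have hcLl : cL ≤ l1 := measureReal_mono Set.inter_subset_right
  have ha0L0 : 0 ≤ a0L := measureReal_nonneg
  have hb0L0 : 0 ≤ b0L := measureReal_nonneg
  have hcL0 : 0 ≤ cL := measureReal_nonneg
  -- forget the definitions of the pieces: from here on everything is polynomial bookkeeping
  clear_value cL cS cH c10 c00 b0H b0S b0L bH bS bL a0H a0S a0L aH aS aL σ l1
  -- the polynomial identity  ℓ¹ℓ⁰·M₂ = ℓ⁰²·s₁₁ + ℓ¹(ℓ¹ − rℓ⁰)·n₁₀ + rℓ¹ℓ⁰·s₀₀ + X̃·U + ℓ¹ℓ⁰·(e_I E₁ + e_II E₂ + e_III E₃)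
  have hid : l1 * (l1 + σ) *
      ((a0H + (a0L + a0S) - a0H) * (bH + (bL + bS) - (bS + bH)) + (aH + (aL + aS) - (aS + aH)) * (b0H + (b0L + b0S) - b0H)
        + (1 - (1 - l1 - σ)) * (cS + cH) + (1 - (1 - l1)) * c00
        - ((1 - l1) - (1 - l1 - σ)) * (aH + (aL + aS)) * (bH + (bL + bS))
        - (1 - (1 - l1)) * ((aH + (aL + aS)) * (b0H + (b0L + b0S)) + (a0H + (a0L + a0S)) * (bH + (bL + bS))))
      = (l1 + σ) * (l1 + σ) * ((aS + aH) * (bS + bH) + (1 - (1 - l1)) * (cS + cH) + (1 - l1) * (aH + (aL + aS)) * (bH + (bL + bS))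
            - (aS + aH) * (bH + (bL + bS)) - (bS + bH) * (aH + (aL + aS)))
        + l1 * (l1 - r * (l1 + σ)) * (aH * b0H + (1 - (1 - l1 - σ)) * c10 + (1 - l1 - σ) * (aH + (aL + aS)) * (b0H + (b0L + b0S))
            - aH * (b0H + (b0L + b0S)) - b0H * (aH + (aL + aS)))
        + l1 * (l1 + σ) * r * (a0H * b0H + (1 - (1 - l1 - σ)) * c00 + (1 - l1 - σ) * (a0H + (a0L + a0S)) * (b0H + (b0L + b0S))
            - a0H * (b0H + (b0L + b0S)) - b0H * (a0H + (a0L + a0S)))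
        + ((l1 + σ) * bL - l1 * (b0L + b0S)) * (aS * l1 - aL * σ)
        + l1 * (l1 + σ) * (((l1 * (bH + (bL + bS)) - bL) - r * ((l1 + σ) * (b0H + (b0L + b0S)) - (b0L + b0S))) * ((aL + aS) - (a0L + a0S))
            + (l1 * (bH + (bL + bS)) - r * ((l1 + σ) * (b0H + (b0L + b0S)))) * ((aH - c10) - (a0H - c00))
            + (r * ((l1 + σ) * (1 - (b0H + (b0L + b0S)))) - l1 * (1 - (bH + (bL + bS)))) * (c10 - c00)) := by
    ring
  by_cases hl1pos : 0 < l1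
  · have hpos : 0 < l1 * (l1 + σ) := mul_pos hl1pos (by linarith)
    refine (mul_nonneg_iff_of_pos_left hpos).1 ?_
    rw [hid]
    have t1 : 0 ≤ (l1 + σ) * (l1 + σ) * ((aS + aH) * (bS + bH) + (1 - (1 - l1)) * (cS + cH)
        + (1 - l1) * (aH + (aL + aS)) * (bH + (bL + bS)) - (aS + aH) * (bH + (bL + bS)) - (bS + bH) * (aH + (aL + aS))) :=
      mul_nonneg (mul_nonneg (by linarith) (by linarith)) h11'
    have t2 : 0 ≤ l1 * (l1 - r * (l1 + σ)) * (aH * b0H + (1 - (1 - l1 - σ)) * c10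
        + (1 - l1 - σ) * (aH + (aL + aS)) * (b0H + (b0L + b0S)) - aH * (b0H + (b0L + b0S)) - b0H * (aH + (aL + aS))) :=
      mul_nonneg (mul_nonneg hl1 (by linarith)) h10'
    have t3 : 0 ≤ l1 * (l1 + σ) * r * (a0H * b0H + (1 - (1 - l1 - σ)) * c00
        + (1 - l1 - σ) * (a0H + (a0L + a0S)) * (b0H + (b0L + b0S)) - a0H * (b0H + (b0L + b0S)) - b0H * (a0H + (a0L + a0S))) :=
      mul_nonneg (mul_nonneg (mul_nonneg hl1 (by linarith)) hr0) h00'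
    have t4 : 0 ≤ ((l1 + σ) * bL - l1 * (b0L + b0S)) * (aS * l1 - aL * σ) := mul_nonneg (by linarith) (by linarith)
    have t5 : 0 ≤ ((l1 * (bH + (bL + bS)) - bL) - r * ((l1 + σ) * (b0H + (b0L + b0S)) - (b0L + b0S))) * ((aL + aS) - (a0L + a0S)) :=
      mul_nonneg (by linarith) (by linarith)
    have t6 : 0 ≤ (l1 * (bH + (bL + bS)) - r * ((l1 + σ) * (b0H + (b0L + b0S)))) * ((aH - c10) - (a0H - c00)) :=
      mul_nonneg (by linarith) (by linarith)
    have t7 : 0 ≤ (r * ((l1 + σ) * (1 - (b0H + (b0L + b0S)))) - l1 * (1 - (bH + (bL + bS)))) * (c10 - c00) :=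
      mul_nonneg (by linarith) (by linarith)
    have t567 : 0 ≤ l1 * (l1 + σ) * (((l1 * (bH + (bL + bS)) - bL) - r * ((l1 + σ) * (b0H + (b0L + b0S)) - (b0L + b0S))) * ((aL + aS) - (a0L + a0S))
            + (l1 * (bH + (bL + bS)) - r * ((l1 + σ) * (b0H + (b0L + b0S)))) * ((aH - c10) - (a0H - c00))
            + (r * ((l1 + σ) * (1 - (b0H + (b0L + b0S)))) - l1 * (1 - (bH + (bL + bS)))) * (c10 - c00)) :=
      mul_nonneg (mul_nonneg hl1 (by linarith)) (by linarith)
    linarith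
  · -- degenerate lower ball: `ℓ¹ = 0`, all `L1`-pieces vanish and `M₂ = σ·Cov(A1,B1) ≥ 0` by Harris
    have hl1z : l1 = 0 := le_antisymm (not_lt.1 hl1pos) hl1
    have haLz : aL = 0 := le_antisymm (hl1z ▸ haLl) haL0
    have hbLz : bL = 0 := le_antisymm (hl1z ▸ hbLl) hbL0
    have ha0Lz : a0L = 0 := le_antisymm (hl1z ▸ ha0Ll) ha0L0
    have hb0Lz : b0L = 0 := le_antisymm (hl1z ▸ hb0Ll) hb0L0
    have hcLz : cL = 0 := le_antisymm (hl1z ▸ hcLl) hcL0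
    have harris : μ.real A1 * μ.real B1 ≤ μ.real (A1 ∩ B1) :=
      prodBernoulli_harris p hA1u hB1u MeasurableSet.of_discrete MeasurableSet.of_discrete
    rw [eA1, eB1, eAB, haLz, hbLz, hcLz] at harris
    rw [hl1z, haLz, hbLz, ha0Lz, hb0Lz]
    have hid0 : (a0H + (0 + a0S) - a0H) * (bH + (0 + bS) - (bS + bH)) + (aH + (0 + aS) - (aS + aH)) * (b0H + (0 + b0S) - b0H)
        + (1 - (1 - 0 - σ)) * (cS + cH) + (1 - (1 - (0:ℝ))) * c00
        - ((1 - 0) - (1 - 0 - σ)) * (aH + (0 + aS)) * (bH + (0 + bS))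
        - (1 - (1 - (0:ℝ))) * ((aH + (0 + aS)) * (b0H + (0 + b0S)) + (a0H + (0 + a0S)) * (bH + (0 + bS)))
        = σ * ((cH + (0 + cS)) - (aH + (0 + aS)) * (bH + (0 + bS))) := by ring
    rw [hid0]
    exact mul_nonneg hσ0 (by linarith)

/-! ## The step under the two conditions `X̃_B ≥ 0`, `Ψ_B ≥ 0` on the constant side -/

/-- For an increasing `U` and the lower ball `L = {N_F < t}`: `μ(U ∩ L) ≤ μ U · μ L` (Harris for an increasing and a decreasing event).
[folklore] -/
theorem real_inter_ball_le_mul (p : ι → unitInterval) (F : Finset ι) {U : Set (Set ι)} (hU : IsUpperSet U) (t : ℕ) :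
    (prodBernoulli p).real (U ∩ {ω : Set ι | (F.filter (· ∈ ω)).card < t}) ≤
      (prodBernoulli p).real U * (prodBernoulli p).real {ω : Set ι | (F.filter (· ∈ ω)).card < t} := by
  set μ := prodBernoulli p with hμ
  set H : Set (Set ι) := {ω : Set ι | t ≤ (F.filter (· ∈ ω)).card} with hH
  set L : Set (Set ι) := {ω : Set ι | (F.filter (· ∈ ω)).card < t} with hL
  have hHu : IsUpperSet H := isUpperSet_threshold F t
  have harris : μ.real U * μ.real H ≤ μ.real (U ∩ H) :=
    prodBernoulli_harris p hU hHu MeasurableSet.of_discrete MeasurableSet.of_discrete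
  have cL : U \ H = U ∩ L := by
    ext ω; simp only [hH, hL, Set.mem_sdiff, Set.mem_inter_iff, Set.mem_setOf_eq, not_le]
  have splitU : μ.real U = μ.real (U ∩ H) + μ.real (U ∩ L) := by
    have h := measureReal_inter_add_sdiff (μ := μ) (s := U) (t := H) MeasurableSet.of_discrete
    rw [cL] at h; linarith
  have cL' : Set.univ \ H = L := by
    ext ω; simp only [hH, hL, Set.mem_sdiff, Set.mem_univ, true_and, Set.mem_setOf_eq, not_le]
  have splitΩ : (1 : ℝ) = μ.real H + μ.real L := by
    have h := measureReal_inter_add_sdiff (μ := μ) (s := Set.univ) (t := H) MeasurableSet.of_discrete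
    rw [Set.univ_inter, cL', probReal_univ] at h; linarith
  have hU1 : μ.real U ≤ 1 := by rw [← probReal_univ (μ := μ)]; exact measureReal_mono (Set.subset_univ _)
  have hU0 : 0 ≤ μ.real U := measureReal_nonneg
  nlinarith

/-- **THE GOOD-PIVOT STEP.**  `e ∉ F`; `A, B` increasing (arbitrary); slot `{N_{insert e F} ≥ t+1}`; `L¹ = {N_F < t}`,
`L⁰ = {N_F < t+1}`, `B¹ ⊇ B⁰` the sections of `B` at `e`.  If `(2′)` holds for `(A¹,B¹)` at `{N_F ≥ t}` and for `(A¹,B⁰)`, `(A⁰,B⁰)`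
at `{N_F ≥ t+1}`, and the pivot is GOOD for `B`:
`X̃_B = ℓ⁰μ(B¹∩L¹) − ℓ¹μ(B⁰∩L⁰) ≥ 0` and `Ψ_B = ℓ⁰(1−b⁰)(ℓ¹b¹ − μ(B¹∩L¹)) − ℓ¹(1−b¹)(ℓ⁰b⁰ − μ(B⁰∩L⁰)) ≥ 0`,
then `(2′)` holds for `(A, B)`.  The AND-literal (`B⁰ = ∅`) and OR-literal (`B¹ = univ`) steps are special cases. [this work] -/
theorem osN_threshold_goodPivot_step (p : ι → unitInterval) {F : Finset ι} {e : ι} (he : e ∉ F) (t : ℕ)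
    {A B : Set (Set ι)} (hA : IsUpperSet A) (hB : IsUpperSet B)
    (h11 : 0 ≤ osN p {ω : Set ι | t ≤ (F.filter (· ∈ ω)).card} (ind {ω : Set ι | insert e ω ∈ A}) (ind {ω : Set ι | insert e ω ∈ B}))
    (h10 : 0 ≤ osN p {ω : Set ι | t + 1 ≤ (F.filter (· ∈ ω)).card} (ind {ω : Set ι | insert e ω ∈ A}) (ind {ω : Set ι | ω \ {e} ∈ B}))
    (h00 : 0 ≤ osN p {ω : Set ι | t + 1 ≤ (F.filter (· ∈ ω)).card} (ind {ω : Set ι | ω \ {e} ∈ A}) (ind {ω : Set ι | ω \ {e} ∈ B}))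
    (hX : (prodBernoulli p).real {ω : Set ι | (F.filter (· ∈ ω)).card < t} *
        (prodBernoulli p).real ({ω : Set ι | ω \ {e} ∈ B} ∩ {ω : Set ι | (F.filter (· ∈ ω)).card < t + 1}) ≤
      (prodBernoulli p).real {ω : Set ι | (F.filter (· ∈ ω)).card < t + 1} *
        (prodBernoulli p).real ({ω : Set ι | insert e ω ∈ B} ∩ {ω : Set ι | (F.filter (· ∈ ω)).card < t}))
    (hΨ : (prodBernoulli p).real {ω : Set ι | (F.filter (· ∈ ω)).card < t} * (1 - (prodBernoulli p).real {ω : Set ι | insert e ω ∈ B}) *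
        ((prodBernoulli p).real {ω : Set ι | (F.filter (· ∈ ω)).card < t + 1} * (prodBernoulli p).real {ω : Set ι | ω \ {e} ∈ B}
          - (prodBernoulli p).real ({ω : Set ι | ω \ {e} ∈ B} ∩ {ω : Set ι | (F.filter (· ∈ ω)).card < t + 1})) ≤
      (prodBernoulli p).real {ω : Set ι | (F.filter (· ∈ ω)).card < t + 1} * (1 - (prodBernoulli p).real {ω : Set ι | ω \ {e} ∈ B}) *
        ((prodBernoulli p).real {ω : Set ι | (F.filter (· ∈ ω)).card < t} * (prodBernoulli p).real {ω : Set ι | insert e ω ∈ B}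
          - (prodBernoulli p).real ({ω : Set ι | insert e ω ∈ B} ∩ {ω : Set ι | (F.filter (· ∈ ω)).card < t}))) :
    0 ≤ osN p {ω : Set ι | t + 1 ≤ ((insert e F).filter (· ∈ ω)).card} (ind A) (ind B) := by
  set μ := prodBernoulli p with hμ
  set L1 : Set (Set ι) := {ω : Set ι | (F.filter (· ∈ ω)).card < t} with hL1
  set L0 : Set (Set ι) := {ω : Set ι | (F.filter (· ∈ ω)).card < t + 1} with hL0
  set B1 : Set (Set ι) := {ω : Set ι | insert e ω ∈ B} with hB1
  set B0 : Set (Set ι) := {ω : Set ι | ω \ {e} ∈ B} with hB0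
  have hB1u : IsUpperSet B1 := isUpperSet_section_insert hB e
  have hB0u : IsUpperSet B0 := isUpperSet_section_sdiff hB e
  have hB01 : B0 ⊆ B1 := section_sdiff_subset_section_insert hB e
  set l1 : ℝ := μ.real L1 with hl1
  set l0 : ℝ := μ.real L0 with hl0
  set b1 : ℝ := μ.real B1 with hb1
  set b0 : ℝ := μ.real B0 with hb0
  set β1 : ℝ := μ.real (B1 ∩ L1) with hβ1
  set β0 : ℝ := μ.real (B0 ∩ L0) with hβ0
  have hl10 : 0 ≤ l1 := measureReal_nonneg
  have hl00 : 0 ≤ l0 := measureReal_nonneg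
  have hl1l0 : l1 ≤ l0 := measureReal_mono fun ω (hω : (F.filter (· ∈ ω)).card < t) => by
    simp only [hL0, Set.mem_setOf_eq]; omega
  have hb01 : b0 ≤ b1 := measureReal_mono hB01
  have hb11 : b1 ≤ 1 := by rw [← probReal_univ (μ := μ)]; exact measureReal_mono (Set.subset_univ _)
  have hb00 : 0 ≤ b0 := measureReal_nonneg
  have hγ1 : β1 ≤ b1 * l1 := real_inter_ball_le_mul p F hB1u t
  have hγ0 : β0 ≤ b0 * l0 := real_inter_ball_le_mul p F hB0u (t + 1)
  change l1 * β0 ≤ l0 * β1 at hX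
  change l1 * (1 - b1) * (l0 * b0 - β0) ≤ l0 * (1 - b0) * (l1 * b1 - β1) at hΨ
  by_cases hb0lt : b0 < 1
  · -- generic case: certificate parameter `r = ℓ¹(1−b¹)/(ℓ⁰(1−b⁰))` (as a product, `r·ℓ⁰(1−b⁰) = ℓ¹(1−b¹)`)
    by_cases hl0pos : 0 < l0
    · have hden : 0 < l0 * (1 - b0) := mul_pos hl0pos (by linarith)
      set r : ℝ := l1 * (1 - b1) / (l0 * (1 - b0)) with hr
      have hrden : r * (l0 * (1 - b0)) = l1 * (1 - b1) := div_mul_cancel₀ _ (ne_of_gt hden)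
      have hr0 : 0 ≤ r := div_nonneg (mul_nonneg hl10 (by linarith)) hden.le
      -- `r ≤ ℓ¹/ℓ⁰` since `1 − b¹ ≤ 1 − b⁰`
      have hr1 : r * l0 ≤ l1 := by
        have h1 : r * l0 * (1 - b0) = l1 * (1 - b1) := by rw [← hrden]; ring
        have h2 : l1 * (1 - b1) ≤ l1 * (1 - b0) := mul_le_mul_of_nonneg_left (by linarith) hl10
        nlinarith
      refine osN_threshold_step_of_pivotCertificate p he t hA hB r hr0 hr1 h11 h10 h00 hX ?_ ?_ ?_
      · -- e_I : r·γ₀ ≤ γ₁  ⟸  Ψ ≥ 0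
        change r * (l0 * b0 - β0) ≤ l1 * b1 - β1
        have h1 : r * (l0 * b0 - β0) * (l0 * (1 - b0)) = l1 * (1 - b1) * (l0 * b0 - β0) := by rw [← hrden]; ring
        nlinarith
      · -- e_II : r·ℓ⁰b⁰ ≤ ℓ¹b¹  ⟸  r ≤ ℓ¹/ℓ⁰ and b⁰ ≤ b¹
        change r * (l0 * b0) ≤ l1 * b1
        nlinarith
      · -- e_III : ℓ¹(1−b¹) ≤ r·ℓ⁰(1−b⁰)  (equality)
        change l1 * (1 - b1) ≤ r * (l0 * (1 - b0))
        rw [hrden]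
    · -- `ℓ⁰ = 0`: then `ℓ¹ = 0` and `r = 0` works
      have hl0z : l0 = 0 := le_antisymm (not_lt.1 hl0pos) hl00
      have hl1z : l1 = 0 := le_antisymm (hl0z ▸ hl1l0) hl10
      refine osN_threshold_step_of_pivotCertificate p he t hA hB 0 le_rfl ?_ h11 h10 h00 hX ?_ ?_ ?_
      · change 0 * l0 ≤ l1; rw [zero_mul]; exact hl10
      · change 0 * (l0 * b0 - β0) ≤ l1 * b1 - β1; nlinarith
      · change 0 * (l0 * b0) ≤ l1 * b1; nlinarith
      · change l1 * (1 - b1) ≤ 0 * (l0 * (1 - b0)); rw [hl1z]; nlinarith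
  · -- `b⁰ = 1`: then `b¹ = 1` and `r = 0` works
    have hb0e : b0 = 1 := le_antisymm (hb01.trans hb11) (not_lt.1 hb0lt)
    have hb1e : b1 = 1 := le_antisymm hb11 (hb0e ▸ hb01)
    refine osN_threshold_step_of_pivotCertificate p he t hA hB 0 le_rfl ?_ h11 h10 h00 hX ?_ ?_ ?_
    · change 0 * l0 ≤ l1; rw [zero_mul]; exact hl10
    · change 0 * (l0 * b0 - β0) ≤ l1 * b1 - β1; nlinarith
    · change 0 * (l0 * b0) ≤ l1 * b1; nlinarith
    · change l1 * (1 - b1) ≤ 0 * (l0 * (1 - b0)); rw [hb1e, hb0e]; simp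

end SahiOneStep

end Summit.CriticalPhenomena.PercolationContinuityZ3.Theorems
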